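import Summits.QuantumFields.QCD.Theses.NestedDissectionSea
import Summits.QuantumFields.QCD.Theorems.NestedDissectionSeaEarlyCrosserLawPinnedLineToolkit

/-!
# The two-sided parity pin forces TORUS crossings inside its window
(crux `EarlyCrosserLaw`, stmt-QuantumFields-13995; shared pin node `stub_pinnedLine` of the lines
`accretive-coarse-jensen` and `kac-rice-hermitian-dos`; lead prover-line-stmt-QuantumFields-13995-1, 2026-08-16)

A deterministic CONSEQUENCE of the pin clauses (b) ∧ (b″) of the crux, for the disprover and the planner: at every
`(reg, M₀ ≥ 0, m, R)` at which the lower pin (b) (`P_k(Re det D_W(m_crit − a_k M/Z_m) < 0) ≥ 1/4` on odd tori of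
physical side `≥ R`) and the upper pin (b″) (`P_k(Re det D_W(m_crit + a_k M/Z_m) < 0) ≤ 1/8` on odd tori of physical
side in `[R, 2R]`) hold, for every `M > M₀`, eventually in `k`, on every odd torus of physical side in `[R, 2R]`:

* `pins_force_signChange` — the phase-quenched probability of the SIGN-CHANGE event
  `{Re det D_W(U, m_crit − a_k M/Z_m, 1) < 0 ∧ ¬ Re det D_W(U, m_crit + a_k M/Z_m, 1) < 0}` is `≥ 1/8`
  (`P(A ∧ ¬B) ≥ P(A) − P(B)`, `ratio_and_not_ge`, on the phase-quenched probability measure);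
* `exists_fermionDet_eq_zero_of_re_neg_of_re_nonneg` — on that event the TORUS Wilson–Dirac operator is singular at
  some bare mass `t ∈ [m_crit − a_k M/Z_m, m_crit + a_k M/Z_m]` (the determinant is real by γ₅-hermiticity,
  `fermionDet_wilsonDirac_im_holds`, and continuous in the mass, which enters additively — intermediate value
  theorem), i.e. the massless torus Wilson operator has a REAL eigenvalue in the pin window of lattice width
  `2 a_k M / Z_m → 0` around `−m_crit(k)`;
* `pins_force_window_crossing` — both together: with probability `≥ 1/8` the torus operator CROSSES INSIDE THE PIN
  WINDOW.  This is the precise sense in which the two-sided pin says "index-carrying real modes concentrate at the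
  line": the complement, at the torus level and inside the window, of clause (a′) (no CELL crossings ABOVE the
  window).  Numbers: with `M = 2 M₀` the window is `± 2 a_k M₀ / Z_m(k)`; Mohler–Schaefer's `⟨n_neg⟩ → 0` per fixed
  physical volume is (b″); topological activity `P(Q odd) ≥ 1/4` is (b).
-/

noncomputable section

open scoped BigOperators Matrix ComplexConjugate
open Filter MeasureTheory
open Literature.MathematicalPhysics.QuantumLattice Literature.MathematicalPhysics.QuantumFieldTheory
  Literature.Probability.LatticeModels
open Summit.QuantumFields.QCD.Theses.NestedDissectionSea
open Summit.QuantumFields.QCD.Cruxes.EarlyCrosserLaw.AccretiveCoarseJensen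

namespace Summit.QuantumFields.QCD.Cruxes.EarlyCrosserLaw.PinnedLine

open scoped Classical

variable {L : ℕ} [NeZero L]

omit [NeZero L] in
/-- The bare mass enters the torus Wilson–Dirac matrix additively: `D_W(U, t, r) = D_W(U, 0, r) + t·1`. [folklore] -/
theorem wilsonDirac_mass_eq_add_smul (U : GaugeConfig 4 L SU3) (t r : ℝ) :
    wilsonDirac (fundamentalRep (Fin 3)) U t r =
      wilsonDirac (fundamentalRep (Fin 3)) U 0 r + ((t : ℝ) : ℂ) • (1 : Matrix _ _ ℂ) := by
  ext p q
  simp only [wilsonDirac, Matrix.of_apply, Matrix.add_apply, Matrix.smul_apply, Matrix.one_apply,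
    smul_eq_mul]
  split_ifs <;> push_cast <;> ring

/-- `t ↦ Re det D_W(U, t, 1)` is continuous (a polynomial in the bare mass). [folklore] -/
theorem continuous_re_fermionDet_mass (U : GaugeConfig 4 L SU3) :
    Continuous fun t : ℝ => (fermionDet (wilsonDirac (fundamentalRep (Fin 3)) U t 1)).re := by
  have hD : Continuous fun t : ℝ => wilsonDirac (fundamentalRep (Fin 3)) U t 1 := by
    have h : (fun t : ℝ => wilsonDirac (fundamentalRep (Fin 3)) U t 1) = fun t : ℝ =>
        wilsonDirac (fundamentalRep (Fin 3)) U 0 1 + ((t : ℝ) : ℂ) • (1 : Matrix _ _ ℂ) := by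
      funext t
      exact wilsonDirac_mass_eq_add_smul U t 1
    rw [h]
    exact continuous_const.add (Complex.continuous_ofReal.smul continuous_const)
  exact Complex.continuous_re.comp hD.matrix_det

/-- **Sign change ⇒ torus crossing in between.** If `Re det D_W(U, t₁, 1) < 0` and `0 ≤ Re det D_W(U, t₂, 1)`
with `t₁ ≤ t₂`, then `det D_W(U, t, 1) = 0` for some `t ∈ [t₁, t₂]` (the determinant is real by γ₅-hermiticity
and continuous in the mass: intermediate value theorem), i.e. `−t` is a real eigenvalue of the massless torus
Wilson operator. [folklore] -/
theorem exists_fermionDet_eq_zero_of_re_neg_of_re_nonneg (U : GaugeConfig 4 L SU3) {t₁ t₂ : ℝ}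
    (h12 : t₁ ≤ t₂) (h1 : (fermionDet (wilsonDirac (fundamentalRep (Fin 3)) U t₁ 1)).re < 0)
    (h2 : 0 ≤ (fermionDet (wilsonDirac (fundamentalRep (Fin 3)) U t₂ 1)).re) :
    ∃ t ∈ Set.Icc t₁ t₂, fermionDet (wilsonDirac (fundamentalRep (Fin 3)) U t 1) = 0 := by
  have hivt := intermediate_value_Icc h12 (continuous_re_fermionDet_mass U).continuousOn
  have h0 : (0 : ℝ) ∈ Set.Icc ((fun t : ℝ => (fermionDet (wilsonDirac (fundamentalRep (Fin 3)) U t 1)).re) t₁)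
      ((fun t : ℝ => (fermionDet (wilsonDirac (fundamentalRep (Fin 3)) U t 1)).re) t₂) := ⟨h1.le, h2⟩
  obtain ⟨t, ht, hft⟩ := hivt h0
  refine ⟨t, ht, Complex.ext ?_ ?_⟩
  · simpa using hft
  · simpa using fermionDet_wilsonDirac_im_holds (L := L) (fundamentalRep (Fin 3))
      (fun g => fundamentalRep_mem_unitaryGroup g) U t 1

/-- **`P(A ∧ ¬B) ≥ P(A) − P(B)`** for measurable events under the crux's phase-quenched ratio (which is the
probability `qcdLatticeMeasure` of the event, `pinnedLine_ratio_eq_measureReal`). [folklore] -/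
theorem ratio_and_not_ge {Nf : ℕ} (L : ℕ) [NeZero L] (β : ℝ) (mq : Fin Nf → ℝ)
    (A B : GaugeConfig 4 L SU3 → Prop) (hA : MeasurableSet {U | A U}) (hB : MeasurableSet {U | B U}) :
    (∫ U, (if A U then (1 : ℝ) else 0) * (∏ f, ‖fermionDet (wilsonDirac (fundamentalRep (Fin 3)) U (mq f) 1)‖)
        ∂(wilsonMeasure (fundamentalRep (Fin 3)) β : Measure (GaugeConfig 4 L SU3))) /
      (∫ U, (∏ f, ‖fermionDet (wilsonDirac (fundamentalRep (Fin 3)) U (mq f) 1)‖)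
        ∂(wilsonMeasure (fundamentalRep (Fin 3)) β : Measure (GaugeConfig 4 L SU3))) -
    (∫ U, (if B U then (1 : ℝ) else 0) * (∏ f, ‖fermionDet (wilsonDirac (fundamentalRep (Fin 3)) U (mq f) 1)‖)
        ∂(wilsonMeasure (fundamentalRep (Fin 3)) β : Measure (GaugeConfig 4 L SU3))) /
      (∫ U, (∏ f, ‖fermionDet (wilsonDirac (fundamentalRep (Fin 3)) U (mq f) 1)‖)
        ∂(wilsonMeasure (fundamentalRep (Fin 3)) β : Measure (GaugeConfig 4 L SU3))) ≤
    (∫ U, (if (A U ∧ ¬ B U) then (1 : ℝ) else 0) *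
        (∏ f, ‖fermionDet (wilsonDirac (fundamentalRep (Fin 3)) U (mq f) 1)‖)
        ∂(wilsonMeasure (fundamentalRep (Fin 3)) β : Measure (GaugeConfig 4 L SU3))) /
      (∫ U, (∏ f, ‖fermionDet (wilsonDirac (fundamentalRep (Fin 3)) U (mq f) 1)‖)
        ∂(wilsonMeasure (fundamentalRep (Fin 3)) β : Measure (GaugeConfig 4 L SU3))) := by
  haveI := isProbabilityMeasure_qcdLatticeMeasure_all (S := L) β mq
  rw [pinnedLine_ratio_eq_measureReal L β mq A hA, pinnedLine_ratio_eq_measureReal L β mq B hB,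
    pinnedLine_ratio_eq_measureReal L β mq (fun U => A U ∧ ¬ B U) (hA.inter hB.compl)]
  have hsub : {U : GaugeConfig 4 L SU3 | A U} ⊆ {U | A U ∧ ¬ B U} ∪ {U | B U} := by
    intro U hU
    by_cases hBU : B U
    · exact Or.inr hBU
    · exact Or.inl ⟨hU, hBU⟩
  have hfin : (qcdLatticeMeasure L β mq) ({U | A U ∧ ¬ B U} ∪ {U | B U}) ≠ ⊤ := measure_ne_top _ _
  have h1 : (qcdLatticeMeasure L β mq).real {U | A U} ≤
      (qcdLatticeMeasure L β mq).real ({U | A U ∧ ¬ B U} ∪ {U | B U}) := measureReal_mono hsub hfin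
  have h2 : (qcdLatticeMeasure L β mq).real ({U | A U ∧ ¬ B U} ∪ {U | B U}) ≤
      (qcdLatticeMeasure L β mq).real {U | A U ∧ ¬ B U} + (qcdLatticeMeasure L β mq).real {U | B U} :=
    measureReal_union_le _ _
  linarith

/-- **The pins force a sign change in the window with probability `≥ 1/8`.**  Lower pin (b) and upper pin (b″)
at `(reg, M₀, m, R)` (texts = the crux's clauses, `let`-free) give, for every `M > M₀`, eventually in `k`, on
every odd torus of physical side in `[R, 2R]`:
`P_k(Re det D_W(m_crit − a_k M/Z_m) < 0 ∧ ¬ Re det D_W(m_crit + a_k M/Z_m) < 0) ≥ 1/4 − 1/8 = 1/8`. -/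
theorem pins_force_signChange {Nf : ℕ} (reg : QCDRegularisation Nf) (M₀ : ℝ) (m : Fin Nf → ℝ) (R : ℝ)
    (hlow : ∀ M : ℝ, M₀ < M → ∀ᶠ k : ℕ in Filter.atTop, ∀ S : ℕ, R ≤ reg.a k * (2 * S + 1) →
      (1 / 4 : ℝ) ≤
        (∫ U, (if (fermionDet (wilsonDirac (fundamentalRep (Fin 3)) U
            (reg.mcrit k - reg.a k * M / reg.Zm k) 1)).re < 0 then (1 : ℝ) else 0) *
            (∏ f, ‖fermionDet (wilsonDirac (fundamentalRep (Fin 3)) U (reg.mcrit k + reg.a k * m f / reg.Zm k) 1)‖)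
          ∂(wilsonMeasure (fundamentalRep (Fin 3)) (reg.β k) : Measure (GaugeConfig 4 (2 * S + 1) SU3))) /
        (∫ U, (∏ f, ‖fermionDet (wilsonDirac (fundamentalRep (Fin 3)) U (reg.mcrit k + reg.a k * m f / reg.Zm k) 1)‖)
          ∂(wilsonMeasure (fundamentalRep (Fin 3)) (reg.β k) : Measure (GaugeConfig 4 (2 * S + 1) SU3))))
    (hup : ∀ M : ℝ, M₀ < M → ∀ᶠ k : ℕ in Filter.atTop, ∀ S : ℕ, R ≤ reg.a k * (2 * S + 1) →
      reg.a k * (2 * S + 1) ≤ 2 * R →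
      (∫ U, (if (fermionDet (wilsonDirac (fundamentalRep (Fin 3)) U
            (reg.mcrit k + reg.a k * M / reg.Zm k) 1)).re < 0 then (1 : ℝ) else 0) *
            (∏ f, ‖fermionDet (wilsonDirac (fundamentalRep (Fin 3)) U (reg.mcrit k + reg.a k * m f / reg.Zm k) 1)‖)
          ∂(wilsonMeasure (fundamentalRep (Fin 3)) (reg.β k) : Measure (GaugeConfig 4 (2 * S + 1) SU3))) /
        (∫ U, (∏ f, ‖fermionDet (wilsonDirac (fundamentalRep (Fin 3)) U (reg.mcrit k + reg.a k * m f / reg.Zm k) 1)‖)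
          ∂(wilsonMeasure (fundamentalRep (Fin 3)) (reg.β k) : Measure (GaugeConfig 4 (2 * S + 1) SU3))) ≤ (1 / 8 : ℝ)) :
    ∀ M : ℝ, M₀ < M → ∀ᶠ k : ℕ in Filter.atTop, ∀ S : ℕ, R ≤ reg.a k * (2 * S + 1) →
      reg.a k * (2 * S + 1) ≤ 2 * R →
      (1 / 8 : ℝ) ≤
        (∫ U, (if ((fermionDet (wilsonDirac (fundamentalRep (Fin 3)) U
              (reg.mcrit k - reg.a k * M / reg.Zm k) 1)).re < 0 ∧
            ¬ (fermionDet (wilsonDirac (fundamentalRep (Fin 3)) U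
              (reg.mcrit k + reg.a k * M / reg.Zm k) 1)).re < 0) then (1 : ℝ) else 0) *
            (∏ f, ‖fermionDet (wilsonDirac (fundamentalRep (Fin 3)) U (reg.mcrit k + reg.a k * m f / reg.Zm k) 1)‖)
          ∂(wilsonMeasure (fundamentalRep (Fin 3)) (reg.β k) : Measure (GaugeConfig 4 (2 * S + 1) SU3))) /
        (∫ U, (∏ f, ‖fermionDet (wilsonDirac (fundamentalRep (Fin 3)) U (reg.mcrit k + reg.a k * m f / reg.Zm k) 1)‖)
          ∂(wilsonMeasure (fundamentalRep (Fin 3)) (reg.β k) : Measure (GaugeConfig 4 (2 * S + 1) SU3))) := by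
  intro M hM
  filter_upwards [hlow M hM, hup M hM] with k hk1 hk2
  intro S hS hS2
  have h1 := hk1 S hS
  have h2 := hk2 S hS hS2
  have h3 := ratio_and_not_ge (2 * S + 1) (reg.β k) (fun f => reg.mcrit k + reg.a k * m f / reg.Zm k)
    (fun U => (fermionDet (wilsonDirac (fundamentalRep (Fin 3)) U (reg.mcrit k - reg.a k * M / reg.Zm k) 1)).re < 0)
    (fun U => (fermionDet (wilsonDirac (fundamentalRep (Fin 3)) U (reg.mcrit k + reg.a k * M / reg.Zm k) 1)).re < 0)
    (pinnedLine_measurableSet_re_fermionDet_neg (2 * S + 1) _)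
    (pinnedLine_measurableSet_re_fermionDet_neg (2 * S + 1) _)
  linarith

/-- **The pins force TORUS CROSSINGS INSIDE THE PIN WINDOW with probability `≥ 1/8`.**  At every `(reg, M₀ ≥ 0, m, R)`
at which (b) and (b″) hold: for every `M > M₀`, eventually in `k`, on every odd torus of physical side in
`[R, 2R]`, the phase-quenched probability of the sign-change event is `≥ 1/8`, and on that event the torus
Wilson–Dirac operator is singular at some bare mass `t ∈ [m_crit(k) − a_k M/Z_m(k), m_crit(k) + a_k M/Z_m(k)]`
(a REAL eigenvalue `−t` of the massless torus Wilson operator inside the window). -/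
theorem pins_force_window_crossing {Nf : ℕ} (reg : QCDRegularisation Nf) (M₀ : ℝ) (hM₀ : 0 ≤ M₀)
    (m : Fin Nf → ℝ) (R : ℝ)
    (hlow : ∀ M : ℝ, M₀ < M → ∀ᶠ k : ℕ in Filter.atTop, ∀ S : ℕ, R ≤ reg.a k * (2 * S + 1) →
      (1 / 4 : ℝ) ≤
        (∫ U, (if (fermionDet (wilsonDirac (fundamentalRep (Fin 3)) U
            (reg.mcrit k - reg.a k * M / reg.Zm k) 1)).re < 0 then (1 : ℝ) else 0) *
            (∏ f, ‖fermionDet (wilsonDirac (fundamentalRep (Fin 3)) U (reg.mcrit k + reg.a k * m f / reg.Zm k) 1)‖)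
          ∂(wilsonMeasure (fundamentalRep (Fin 3)) (reg.β k) : Measure (GaugeConfig 4 (2 * S + 1) SU3))) /
        (∫ U, (∏ f, ‖fermionDet (wilsonDirac (fundamentalRep (Fin 3)) U (reg.mcrit k + reg.a k * m f / reg.Zm k) 1)‖)
          ∂(wilsonMeasure (fundamentalRep (Fin 3)) (reg.β k) : Measure (GaugeConfig 4 (2 * S + 1) SU3))))
    (hup : ∀ M : ℝ, M₀ < M → ∀ᶠ k : ℕ in Filter.atTop, ∀ S : ℕ, R ≤ reg.a k * (2 * S + 1) →
      reg.a k * (2 * S + 1) ≤ 2 * R →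
      (∫ U, (if (fermionDet (wilsonDirac (fundamentalRep (Fin 3)) U
            (reg.mcrit k + reg.a k * M / reg.Zm k) 1)).re < 0 then (1 : ℝ) else 0) *
            (∏ f, ‖fermionDet (wilsonDirac (fundamentalRep (Fin 3)) U (reg.mcrit k + reg.a k * m f / reg.Zm k) 1)‖)
          ∂(wilsonMeasure (fundamentalRep (Fin 3)) (reg.β k) : Measure (GaugeConfig 4 (2 * S + 1) SU3))) /
        (∫ U, (∏ f, ‖fermionDet (wilsonDirac (fundamentalRep (Fin 3)) U (reg.mcrit k + reg.a k * m f / reg.Zm k) 1)‖)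
          ∂(wilsonMeasure (fundamentalRep (Fin 3)) (reg.β k) : Measure (GaugeConfig 4 (2 * S + 1) SU3))) ≤ (1 / 8 : ℝ)) :
    ∀ M : ℝ, M₀ < M → ∀ᶠ k : ℕ in Filter.atTop, ∀ S : ℕ, R ≤ reg.a k * (2 * S + 1) →
      reg.a k * (2 * S + 1) ≤ 2 * R →
      (1 / 8 : ℝ) ≤
        (∫ U, (if ((fermionDet (wilsonDirac (fundamentalRep (Fin 3)) U
              (reg.mcrit k - reg.a k * M / reg.Zm k) 1)).re < 0 ∧
            ¬ (fermionDet (wilsonDirac (fundamentalRep (Fin 3)) U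
              (reg.mcrit k + reg.a k * M / reg.Zm k) 1)).re < 0) then (1 : ℝ) else 0) *
            (∏ f, ‖fermionDet (wilsonDirac (fundamentalRep (Fin 3)) U (reg.mcrit k + reg.a k * m f / reg.Zm k) 1)‖)
          ∂(wilsonMeasure (fundamentalRep (Fin 3)) (reg.β k) : Measure (GaugeConfig 4 (2 * S + 1) SU3))) /
        (∫ U, (∏ f, ‖fermionDet (wilsonDirac (fundamentalRep (Fin 3)) U (reg.mcrit k + reg.a k * m f / reg.Zm k) 1)‖)
          ∂(wilsonMeasure (fundamentalRep (Fin 3)) (reg.β k) : Measure (GaugeConfig 4 (2 * S + 1) SU3))) ∧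
      ∀ U : GaugeConfig 4 (2 * S + 1) SU3,
        ((fermionDet (wilsonDirac (fundamentalRep (Fin 3)) U (reg.mcrit k - reg.a k * M / reg.Zm k) 1)).re < 0 ∧
          ¬ (fermionDet (wilsonDirac (fundamentalRep (Fin 3)) U (reg.mcrit k + reg.a k * M / reg.Zm k) 1)).re < 0) →
        ∃ t ∈ Set.Icc (reg.mcrit k - reg.a k * M / reg.Zm k) (reg.mcrit k + reg.a k * M / reg.Zm k),
          fermionDet (wilsonDirac (fundamentalRep (Fin 3)) U t 1) = 0 := by
  intro M hM
  filter_upwards [pins_force_signChange reg M₀ m R hlow hup M hM] with k hk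
  intro S hS hS2
  refine ⟨hk S hS hS2, fun U hU => ?_⟩
  have hw : 0 ≤ reg.a k * M / reg.Zm k :=
    div_nonneg (mul_nonneg (reg.a_pos k).le (hM₀.trans hM.le)) (reg.Zm_pos k).le
  exact exists_fermionDet_eq_zero_of_re_neg_of_re_nonneg U (by linarith) hU.1 (not_lt.mp hU.2)

end Summit.QuantumFields.QCD.Cruxes.EarlyCrosserLaw.PinnedLine

end
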